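import Mathlib.Tactic

/-!
# The excess identity of an aggregated feeder set (pub-hsemireg, W2 seat w2-t1-1, gen 23, items (iv) / (v′-1))

Kernel transcription of the polynomial content of the EXCESS used by THEOREM (41-M) of the record addendum
`widen/W2/w2t11/symlaw/liveproof/ADDENDUM-M.md` and by the norm-capped (SC-MULTI) censuses of
`ADDENDUM-CAP.md` (to `LIVELAW-w2t11g23.md`).  LINEAGE SIDE (not formalised): a feeder set on a free pencil
`i` with weights `w_k > 0` and class parameters `s_k ∈ K = ℚ(ω)` has aggregates `W_i = Σ w_k`,
`S_i = Σ w_k s_k`, `N_i = Σ w_k N(s_k)`; THEOREM (41-M) says the set enters the live system only through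
`(W_i, S_i)` and the EXCESS `x_i = N_i - N(S_i)/W_i = Σ w_k N(s_k - S_i/W_i) ≥ 0`, and the k-first census
(`capcensus2.py`) realises a prescribed excess with two types through the norm equation
`w₁ w₂ N(s₁ - s₂) = W_i x_i`.
WHAT IS CHECKED HERE, with the norm form of `K` written out in coordinates, `N(p + qω) = p² - p q + q²`, over a commutative ring (identities) resp. an ordered field (signs):
* `excess_two`: `(w₁ + w₂) (w₁ N(a) + w₂ N(b)) - N(w₁ a + w₂ b) = w₁ w₂ N(a - b)` (coordinatewise), i.e.
  `x = w₁ w₂ N(s₁ - s₂)/W` for two types — the norm equation of the k-first census;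
* `excess_two_centered`: the same excess equals `w₁ N(s₁ - s̄) + w₂ N(s₂ - s̄)` times `W`, where `W s̄ = S`
  (stated polynomially: multiplied through by `W²`);
* `excess_three_centered`: the three-type centred form (multiplied through by `W²`);
* `Nf_nonneg`: `0 ≤ p² - p q + q²`;  `excess_two_nonneg`: for `w₁, w₂ ≥ 0` the two-type excess
  `(w₁ + w₂)(w₁ N(a) + w₂ N(b)) - N(w₁ a + w₂ b)` is `≥ 0` — the sign `x_i ≥ 0` of THEOREM (41-M) for two types;
* `Nf_eq_zero`: `p² - p q + q² = 0 ↔ p = 0 ∧ q = 0` — so `x = 0` iff the two types coincide (`w₁ w₂ ≠ 0`),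
  `excess_two_eq_zero`.
RECORD ONLY; W2 counts 0 ∕ 0 ∕ 0 unchanged.  Honest framing: identities of the lineage's own formulas; nothing
here says HC / HC_CM / HC_AV is proved.
-/

namespace Summit.Ventures.HSemireg.ExcessIdentity

section identities

variable {R : Type*} [CommRing R]

/-- Two-type excess identity (parallel-axis form): with `a = (a0, a1)`, `b = (b0, b1)` the coordinates of
`s₁, s₂` and weights `w₁, w₂`,
`(w₁ + w₂) (w₁ N(s₁) + w₂ N(s₂)) - N(w₁ s₁ + w₂ s₂) = w₁ w₂ N(s₁ - s₂)`. -/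
theorem excess_two (w₁ w₂ a0 a1 b0 b1 : R) :
    (w₁ + w₂) * (w₁ * (a0 ^ 2 - a0 * a1 + a1 ^ 2) + w₂ * (b0 ^ 2 - b0 * b1 + b1 ^ 2)) - ((w₁ * a0 + w₂ * b0) ^ 2 - (w₁ * a0 + w₂ * b0) * (w₁ * a1 + w₂ * b1) + (w₁ * a1 + w₂ * b1) ^ 2)
      = w₁ * w₂ * ((a0 - b0) ^ 2 - (a0 - b0) * (a1 - b1) + (a1 - b1) ^ 2) := by
  ring

/-- Two-type excess, centred form multiplied by `W²` (`W = w₁ + w₂`, `S = w₁ s₁ + w₂ s₂`, `s̄ = S/W`):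
`W · (W N_i - N(S)) = w₁ N(W s₁ - S) + w₂ N(W s₂ - S)`, i.e. `x = Σ w_k N(s_k - s̄)`. -/
theorem excess_two_centered (w₁ w₂ a0 a1 b0 b1 : R) :
    (w₁ + w₂) * ((w₁ + w₂) * (w₁ * (a0 ^ 2 - a0 * a1 + a1 ^ 2) + w₂ * (b0 ^ 2 - b0 * b1 + b1 ^ 2)) - ((w₁ * a0 + w₂ * b0) ^ 2 - (w₁ * a0 + w₂ * b0) * (w₁ * a1 + w₂ * b1) + (w₁ * a1 + w₂ * b1) ^ 2))
      = w₁ * (((w₁ + w₂) * a0 - (w₁ * a0 + w₂ * b0)) ^ 2 - ((w₁ + w₂) * a0 - (w₁ * a0 + w₂ * b0)) * ((w₁ + w₂) * a1 - (w₁ * a1 + w₂ * b1)) + ((w₁ + w₂) * a1 - (w₁ * a1 + w₂ * b1)) ^ 2)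
        + w₂ * (((w₁ + w₂) * b0 - (w₁ * a0 + w₂ * b0)) ^ 2 - ((w₁ + w₂) * b0 - (w₁ * a0 + w₂ * b0)) * ((w₁ + w₂) * b1 - (w₁ * a1 + w₂ * b1)) + ((w₁ + w₂) * b1 - (w₁ * a1 + w₂ * b1)) ^ 2) := by
  ring

/-- Three-type excess, centred form multiplied by `W²`:
`W · (W N_i - N(S)) = Σ_k w_k N(W s_k - S)` for three types. -/
theorem excess_three_centered (w₁ w₂ w₃ a0 a1 b0 b1 c0 c1 : R) :
    (w₁ + w₂ + w₃) * ((w₁ + w₂ + w₃) * (w₁ * (a0 ^ 2 - a0 * a1 + a1 ^ 2) + w₂ * (b0 ^ 2 - b0 * b1 + b1 ^ 2) + w₃ * (c0 ^ 2 - c0 * c1 + c1 ^ 2))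
        - ((w₁ * a0 + w₂ * b0 + w₃ * c0) ^ 2 - (w₁ * a0 + w₂ * b0 + w₃ * c0) * (w₁ * a1 + w₂ * b1 + w₃ * c1) + (w₁ * a1 + w₂ * b1 + w₃ * c1) ^ 2))
      = w₁ * (((w₁ + w₂ + w₃) * a0 - (w₁ * a0 + w₂ * b0 + w₃ * c0)) ^ 2 - ((w₁ + w₂ + w₃) * a0 - (w₁ * a0 + w₂ * b0 + w₃ * c0)) * ((w₁ + w₂ + w₃) * a1 - (w₁ * a1 + w₂ * b1 + w₃ * c1)) + ((w₁ + w₂ + w₃) * a1 - (w₁ * a1 + w₂ * b1 + w₃ * c1)) ^ 2)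
        + w₂ * (((w₁ + w₂ + w₃) * b0 - (w₁ * a0 + w₂ * b0 + w₃ * c0)) ^ 2 - ((w₁ + w₂ + w₃) * b0 - (w₁ * a0 + w₂ * b0 + w₃ * c0)) * ((w₁ + w₂ + w₃) * b1 - (w₁ * a1 + w₂ * b1 + w₃ * c1)) + ((w₁ + w₂ + w₃) * b1 - (w₁ * a1 + w₂ * b1 + w₃ * c1)) ^ 2)
        + w₃ * (((w₁ + w₂ + w₃) * c0 - (w₁ * a0 + w₂ * b0 + w₃ * c0)) ^ 2 - ((w₁ + w₂ + w₃) * c0 - (w₁ * a0 + w₂ * b0 + w₃ * c0)) * ((w₁ + w₂ + w₃) * c1 - (w₁ * a1 + w₂ * b1 + w₃ * c1)) + ((w₁ + w₂ + w₃) * c1 - (w₁ * a1 + w₂ * b1 + w₃ * c1)) ^ 2) := by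
  ring

/-- Three-type excess as a sum of pairwise norm distances: `W · x · W = Σ_{k<l} w_k w_l N(s_k - s_l)`
(multiplied by `W`): `W N_i - N(S) = (1/W) Σ_{k<l} w_k w_l N(s_k - s_l)`. -/
theorem excess_three_pairs (w₁ w₂ w₃ a0 a1 b0 b1 c0 c1 : R) :
    (w₁ + w₂ + w₃) * (w₁ * (a0 ^ 2 - a0 * a1 + a1 ^ 2) + w₂ * (b0 ^ 2 - b0 * b1 + b1 ^ 2) + w₃ * (c0 ^ 2 - c0 * c1 + c1 ^ 2))
        - ((w₁ * a0 + w₂ * b0 + w₃ * c0) ^ 2 - (w₁ * a0 + w₂ * b0 + w₃ * c0) * (w₁ * a1 + w₂ * b1 + w₃ * c1) + (w₁ * a1 + w₂ * b1 + w₃ * c1) ^ 2)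
      = w₁ * w₂ * ((a0 - b0) ^ 2 - (a0 - b0) * (a1 - b1) + (a1 - b1) ^ 2) + w₁ * w₃ * ((a0 - c0) ^ 2 - (a0 - c0) * (a1 - c1) + (a1 - c1) ^ 2)
        + w₂ * w₃ * ((b0 - c0) ^ 2 - (b0 - c0) * (b1 - c1) + (b1 - c1) ^ 2) := by
  ring

/-- Completing the square: `4 N(p + qω) = (2p - q)² + 3 q²`. -/
theorem four_Nf (p q : R) : 4 * (p ^ 2 - p * q + q ^ 2) = (2 * p - q) ^ 2 + 3 * q ^ 2 := by
  ring

end identities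

section signs

variable {K : Type*} [Field K] [LinearOrder K] [IsStrictOrderedRing K]

/-- The norm form is nonnegative: `0 ≤ p² - pq + q²`. -/
theorem Nf_nonneg (p q : K) : 0 ≤ (p ^ 2 - p * q + q ^ 2) := by
  have h := four_Nf p q
  nlinarith [sq_nonneg (2 * p - q), sq_nonneg q]

/-- The norm form vanishes only at the origin. -/
theorem Nf_eq_zero (p q : K) : (p ^ 2 - p * q + q ^ 2) = 0 ↔ p = 0 ∧ q = 0 := by
  constructor
  · intro h
    have h4 := four_Nf p q
    rw [h, mul_zero] at h4
    have hq : q = 0 := by nlinarith [sq_nonneg (2 * p - q), sq_nonneg q]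
    subst hq
    have hp : (2 * p) ^ 2 = 0 := by nlinarith [sq_nonneg (2 * p)]
    have := pow_eq_zero_iff (n := 2) (by norm_num) |>.mp hp
    constructor
    · linarith
    · rfl
  · rintro ⟨rfl, rfl⟩
    ring

/-- Sign of the two-type excess (THEOREM (41-M): `x_i ≥ 0`): for `w₁, w₂ ≥ 0`,
`N(w₁ s₁ + w₂ s₂) ≤ (w₁ + w₂)(w₁ N(s₁) + w₂ N(s₂))`. -/
theorem excess_two_nonneg (w₁ w₂ a0 a1 b0 b1 : K) (h₁ : 0 ≤ w₁) (h₂ : 0 ≤ w₂) :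
    0 ≤ (w₁ + w₂) * (w₁ * (a0 ^ 2 - a0 * a1 + a1 ^ 2) + w₂ * (b0 ^ 2 - b0 * b1 + b1 ^ 2)) - ((w₁ * a0 + w₂ * b0) ^ 2 - (w₁ * a0 + w₂ * b0) * (w₁ * a1 + w₂ * b1) + (w₁ * a1 + w₂ * b1) ^ 2) := by
  rw [excess_two]
  exact mul_nonneg (mul_nonneg h₁ h₂) (Nf_nonneg _ _)

/-- The two-type excess vanishes iff the two types coincide (positive weights): `x = 0 ↔ s₁ = s₂`. -/
theorem excess_two_eq_zero (w₁ w₂ a0 a1 b0 b1 : K) (h₁ : 0 < w₁) (h₂ : 0 < w₂) :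
    (w₁ + w₂) * (w₁ * (a0 ^ 2 - a0 * a1 + a1 ^ 2) + w₂ * (b0 ^ 2 - b0 * b1 + b1 ^ 2)) - ((w₁ * a0 + w₂ * b0) ^ 2 - (w₁ * a0 + w₂ * b0) * (w₁ * a1 + w₂ * b1) + (w₁ * a1 + w₂ * b1) ^ 2) = 0
      ↔ a0 = b0 ∧ a1 = b1 := by
  rw [excess_two, mul_eq_zero, Nf_eq_zero, sub_eq_zero, sub_eq_zero]
  constructor
  · rintro (h | h)
    · exact absurd h (mul_pos h₁ h₂).ne'
    · exact h
  · intro h; exact Or.inr h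

end signs

section census

/-- The k-first norm equation (capcensus2.py): for two types with `W = w₁ + w₂`, prescribing the excess
`x` (here `W x = W N_i - N(S)`, everything multiplied by `W`) is the same as prescribing
`N(s₁ - s₂) = W x/(w₁ w₂)`: `W · (W N_i - N(S))/W = w₁ w₂ N(s₁ - s₂)` restated with `x` explicit. -/
theorem norm_equation {K : Type*} [Field K] (w₁ w₂ a0 a1 b0 b1 x : K) (hW : w₁ + w₂ ≠ 0)
    (hx : x = (w₁ * (a0 ^ 2 - a0 * a1 + a1 ^ 2) + w₂ * (b0 ^ 2 - b0 * b1 + b1 ^ 2)) - ((w₁ * a0 + w₂ * b0) ^ 2 - (w₁ * a0 + w₂ * b0) * (w₁ * a1 + w₂ * b1) + (w₁ * a1 + w₂ * b1) ^ 2) / (w₁ + w₂)) :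
    (w₁ + w₂) * x = w₁ * w₂ * ((a0 - b0) ^ 2 - (a0 - b0) * (a1 - b1) + (a1 - b1) ^ 2) := by
  rw [← excess_two, hx]
  field_simp

end census

end Summit.Ventures.HSemireg.ExcessIdentity
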